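import Literature.NumberTheory.Sieve.GrimmeltMerikoski2025
import HarnessLib

/-!
# Grimmelt–Merikoski 2025, Theorem 1.4 in the range its proof treats (`K ≤ D·X^{1+o(1)}`)

Companion to `GrimmeltMerikoski2025.lean` (same topic `Literature/NumberTheory/Sieve`), filing
the named fact announced there (§Erratum of its module docstring): the printed Theorem 1.4
(`grimmeltMerikoski2025_thm14`, vendored verbatim) asserts the range `1 ≤ D ≤ K ≤ X²` and is
FALSE at the edge `K = X²`, `D = 1` (`grimmeltMerikoski2025_thm14_false`,
`GrimmeltMerikoski2025Counterexample.lean`).  The proof in the paper (§5, p. 13) opens with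
"We may assume that for some small `η > 0` we have `K > X^{1−η}`, since otherwise the claim is
trivial by applying Poisson summation on `ℓ`.  Similarly, we may assume that `K ≤ DX^{1+η}` since
otherwise the claim is trivial by switcing to the complementary divisor `m = (aℓ²+h)/k` and
applying Poisson summation on `ℓ` modulo `dm`."  The first reduction is sound; the second is the
faulty one (the complementary Poisson main term does not match the subtracted one when
`X²/K ≍ 1`, loc. cit.).  What §5 establishes (via [GMtechnical, Thm 2.1]) is therefore Theorem 1.4
WITH the extra hypothesis `K ≤ D·X^{1+η}`, which we vendor here in the `ε`–`δ` reading of the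
file's conventions (`η ↦ δ`, the slack depending on `ε` only) as
`grimmeltMerikoski2025_thm14_restricted`, together with the `a = h = 1` corollary
`grimmeltMerikoski2025_thm14_restricted_one` (PROVED from it exactly as
`grimmeltMerikoski2025_thm14_one`, the extra hypothesis threaded through).  The restricted range
contains every application in the paper (moduli `K ≤ X^{1.312}`) and the ranges wanted by route
`Parity/KloostermanFractions` (`K ∈ [X^{1−δ'}, X^{1+δ'}]`, `D ≤ X^{1/2−ε}`: item
`Summit.Parity.BatemanHorn.Theses.KloostermanFractions.TypeIBelowHalf`, stmt-Parity-6769, whose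
SHARP cut-offs in `k` and `ℓ` and sub-dyadic `(K, K']` are NOT this smooth statement — the item is
stronger than print by an unsmoothing step) and `Parity/QuadraticRoots`.

Everything else — objects `GM2025.rho/rootSum/rootDiscrepancy/typeISum`, admissible weights,
the `≺≺` conventions, `θ = 7/64` — is imported unchanged from `GrimmeltMerikoski2025.lean`.

## References

* [GrimmeltMerikoski2025] L. Grimmelt, J. Merikoski, arXiv:2505.00493, §1.1 Theorem 1.4; §5,
  first paragraph (p. 13) for the range actually treated; remark after Theorem 1.5 (p. 4) for the
  simplified bound `D X^{1/2}(1 + X/D²)^θ` at `h ≺≺ D²`.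
-/

noncomputable section

namespace Literature.NumberTheory.Sieve

open GM2025

/-- **Grimmelt–Merikoski 2025, Theorem 1.4 (Type I estimate) in the range `K ≤ D·X^{1+δ}` treated
by its proof** (statement only; `θ = 7/64`, `ε`–`δ` reading of `≺≺` as in
`grimmeltMerikoski2025_thm14`): for every `ε > 0` there are `δ > 0`, `J`, `X₀` such that for
`X ≥ X₀`, `1 ≤ D ≤ K ≤ X²`, **`K ≤ D·X^{1+δ}`**, `D ≤ X^{1/2}`, `h` square-free with
`1 ≤ h ≤ X^{2+δ}`, `1 ≤ a ≤ X^δ`, `gcd(a,h) = 1`, and smooth `ψ₁`, `ψ₂` supported on `[1,2]`,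
`[-1,1]` with `‖ψᵢ^{(j)}‖_∞ ≤ X^δ` (`j ≤ J`):
`∑_{d ≤ D} |∑_{k ≡ 0 (d)} ψ₁(k/K)(∑_{aℓ²+h ≡ 0 (k)} ψ₂(ℓ/X) − ρ_{a,h}(k) X ∫ψ₂ / k)|
 ≤ X^ε · D^{1/2} X^{1/2} (D^{1/2} + h^{1/4}) (1 + X/(D(D + h^{1/2})))^{7/64}`.
This is the printed Theorem 1.4 with the single extra hypothesis `K ≤ DX^{1+η}` under which §5
("we may assume that `K ≤ DX^{1+η}`", p. 13) proves it; the printed full range `K ≤ X²` is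
refuted in tree (`grimmeltMerikoski2025_thm14_false`). Grounds (smooth form of)
`Summit.Parity.BatemanHorn.Theses.KloostermanFractions.TypeIBelowHalf`.
[cite: GrimmeltMerikoski2025, Theorem 1.4 and §5 (first paragraph)] -/
def grimmeltMerikoski2025_thm14_restricted : Prop :=
  ∀ ε : ℝ, 0 < ε → ∃ δ : ℝ, 0 < δ ∧ ∃ J : ℕ, ∃ X₀ : ℝ, ∀ X : ℝ, X₀ ≤ X →
    ∀ D K : ℝ, 1 ≤ D → D ≤ K → K ≤ X ^ 2 → K ≤ D * X ^ (1 + δ) → D ≤ X ^ (1 / 2 : ℝ) →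
    ∀ h : ℕ, 1 ≤ h → Squarefree h → (h : ℝ) ≤ X ^ (2 + δ) →
    ∀ a : ℕ, 1 ≤ a → (a : ℝ) ≤ X ^ δ → Nat.Coprime a h →
    ∀ ψ₁ ψ₂ : ℝ → ℂ, IsAdmissibleWeight ψ₁ 1 2 J (X ^ δ) →
      IsAdmissibleWeight ψ₂ (-1) 1 J (X ^ δ) →
      typeISum a h ψ₁ ψ₂ X K D ≤
        X ^ ε * (D ^ (1 / 2 : ℝ) * X ^ (1 / 2 : ℝ) * (D ^ (1 / 2 : ℝ) + (h : ℝ) ^ (1 / 4 : ℝ)) *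
          (1 + X / (D * (D + (h : ℝ) ^ (1 / 2 : ℝ)))) ^ (7 / 64 : ℝ))

/-- **Theorem 1.4 for `ℓ² + 1` in the treated range** (PROVED from
`grimmeltMerikoski2025_thm14_restricted` with `a = h = 1`, exactly as
`grimmeltMerikoski2025_thm14_one`: `D^{1/2} + 1 ≤ 2D^{1/2}`, `X/(D(D+1)) ≤ X/D²`, the factor `2`
absorbed into `X^ε`): for every `ε > 0` there are `δ > 0`, `J`, `X₀` such that for `X ≥ X₀`,
`1 ≤ D ≤ K ≤ X²`, `K ≤ D·X^{1+δ}`, `D ≤ X^{1/2}` and admissible `ψ₁, ψ₂` (derivatives `≤ X^δ` up to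
order `J`),
`∑_{d ≤ D} |∑_{k ≡ 0 (d)} ψ₁(k/K)(∑_{ℓ²+1 ≡ 0 (k)} ψ₂(ℓ/X) − ρ(k) X ∫ψ₂/k)| ≤ X^ε · D X^{1/2} (1 + X/D²)^{7/64}`
— the paper's simplified Type I bound for the small-root sequence of `ℓ² + 1`, non-trivial
exactly for `D < X^{1/2}`; the smooth-weight form of the Type I input below the diagonal wanted by
route Parity/KloostermanFractions (`TypeIBelowHalf`).
[cite: GrimmeltMerikoski2025, Theorem 1.4 and the remark after Theorem 1.5] -/
theorem grimmeltMerikoski2025_thm14_restricted_one (hGM : grimmeltMerikoski2025_thm14_restricted) :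
    ∀ ε : ℝ, 0 < ε → ∃ δ : ℝ, 0 < δ ∧ ∃ J : ℕ, ∃ X₀ : ℝ, ∀ X : ℝ, X₀ ≤ X →
      ∀ D K : ℝ, 1 ≤ D → D ≤ K → K ≤ X ^ 2 → K ≤ D * X ^ (1 + δ) → D ≤ X ^ (1 / 2 : ℝ) →
      ∀ ψ₁ ψ₂ : ℝ → ℂ, IsAdmissibleWeight ψ₁ 1 2 J (X ^ δ) →
        IsAdmissibleWeight ψ₂ (-1) 1 J (X ^ δ) →
        typeISum 1 1 ψ₁ ψ₂ X K D ≤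
          X ^ ε * (D * X ^ (1 / 2 : ℝ) * (1 + X / D ^ 2) ^ (7 / 64 : ℝ)) := by
  intro ε hε
  obtain ⟨δ, hδ, J, X₀, hmain⟩ := hGM (ε / 2) (half_pos hε)
  refine ⟨δ, hδ, J, max X₀ (max 1 ((2 : ℝ) ^ (1 / (ε / 2)))),
    fun X hX D K hD1 hDK hKX hKD hDX ψ₁ ψ₂ hψ₁ hψ₂ => ?_⟩
  have hX₀ : X₀ ≤ X := (le_max_left _ _).trans hX
  have hX1 : (1 : ℝ) ≤ X := ((le_max_left _ _).trans (le_max_right _ _)).trans hX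
  have hX2 : (2 : ℝ) ^ (1 / (ε / 2)) ≤ X := ((le_max_right _ _).trans (le_max_right _ _)).trans hX
  have hX0 : (0 : ℝ) ≤ X := zero_le_one.trans hX1
  have hD0 : (0 : ℝ) < D := zero_lt_one.trans_le hD1
  -- the restricted theorem at `a = h = 1`
  have h1 := hmain X hX₀ D K hD1 hDK hKX hKD hDX 1 le_rfl squarefree_one
    (by rw [Nat.cast_one]; exact Real.one_le_rpow hX1 (by linarith))
    1 le_rfl (by rw [Nat.cast_one]; exact Real.one_le_rpow hX1 hδ.le) (Nat.coprime_one_right 1)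
    ψ₁ ψ₂ hψ₁ hψ₂
  simp only [Nat.cast_one, Real.one_rpow] at h1
  -- simplify the bound
  have hsqrtD : (1 : ℝ) ≤ D ^ (1 / 2 : ℝ) := Real.one_le_rpow hD1 (by norm_num)
  have hDD : D ^ (1 / 2 : ℝ) * D ^ (1 / 2 : ℝ) = D := by
    rw [← Real.rpow_add hD0]; norm_num
  have hfrac : X / (D * (D + 1)) ≤ X / D ^ 2 := by
    apply div_le_div_of_nonneg_left hX0 (by positivity)
    nlinarith
  have hpow : (1 + X / (D * (D + 1))) ^ (7 / 64 : ℝ) ≤ (1 + X / D ^ 2) ^ (7 / 64 : ℝ) :=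
    Real.rpow_le_rpow (by positivity) (by linarith) (by norm_num)
  have hpow0 : (0 : ℝ) ≤ (1 + X / D ^ 2) ^ (7 / 64 : ℝ) := Real.rpow_nonneg (by positivity) _
  have hXe : (0 : ℝ) ≤ X ^ (ε / 2) := Real.rpow_nonneg hX0 _
  have hX12 : (0 : ℝ) ≤ X ^ (1 / 2 : ℝ) := Real.rpow_nonneg hX0 _
  have htwo : (2 : ℝ) ≤ X ^ (ε / 2) := two_le_rpow_of_le (half_pos hε) hX2
  have hXee : X ^ (ε / 2) * X ^ (ε / 2) = X ^ ε := by
    rw [← Real.rpow_add_of_nonneg hX0 (half_pos hε).le (half_pos hε).le, add_halves]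
  calc typeISum 1 1 ψ₁ ψ₂ X K D
      ≤ X ^ (ε / 2) * (D ^ (1 / 2 : ℝ) * X ^ (1 / 2 : ℝ) * (D ^ (1 / 2 : ℝ) + 1) *
          (1 + X / (D * (D + 1))) ^ (7 / 64 : ℝ)) := h1
    _ ≤ X ^ (ε / 2) * (D ^ (1 / 2 : ℝ) * X ^ (1 / 2 : ℝ) * (2 * D ^ (1 / 2 : ℝ)) *
          (1 + X / D ^ 2) ^ (7 / 64 : ℝ)) := by
        gcongr
        linarith
    _ = 2 * X ^ (ε / 2) * (D * X ^ (1 / 2 : ℝ) * (1 + X / D ^ 2) ^ (7 / 64 : ℝ)) := by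
        linear_combination (2 * X ^ (ε / 2) * X ^ (1 / 2 : ℝ) * (1 + X / D ^ 2) ^ (7 / 64 : ℝ)) * hDD
    _ ≤ X ^ (ε / 2) * X ^ (ε / 2) * (D * X ^ (1 / 2 : ℝ) * (1 + X / D ^ 2) ^ (7 / 64 : ℝ)) := by
        gcongr
    _ = X ^ ε * (D * X ^ (1 / 2 : ℝ) * (1 + X / D ^ 2) ^ (7 / 64 : ℝ)) := by rw [hXee]

end Literature.NumberTheory.Sieve

end
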